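import Mathlib.Topology.UniformSpace.HeineCantor
import Mathlib.Topology.Order.Compact
import Mathlib.Topology.Instances.Real.Lemmas

/-!
# Crux `PerpetualPump.AveragedTypeIBlowup` (stmt-NavierStokesRegularity-1835), line `Sketch`:
# stub `supContinuity` — a running supremum up to a moving time is continuous

This file proves the registered stub `stub_supContinuity` of the line skeleton
`Cruxes/AveragedTypeIBlowup/Lines/Sketch.lean`. In the nested-interval shooting argument the
quantity `β_k(A) := sup_{t ∈ [0, T_k(A)]} b_{n₀+k}(t; A)` (the renormalised peak of the `k`-th
carrier up to the cut-off time `T_k(A)`) must depend continuously on the datum amplitude `A`;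
joint continuity of `(A, t) ↦ b` and continuity of the cut-off time are supplied by other stubs,
and the present file is the abstract real-analysis glue:

* data: `g : ℝ → ℝ → ℝ` with `Function.uncurry g` continuous on the compact rectangle
  `K := [A₀ - δ, A₀ + δ] × [a, T + δ]`, a "moving time" `τ : ℝ → ℝ` with `τ A₀ = T ≥ a`, continuous
  at `A₀` in the `ε`/`d` sense and with `a ≤ τ A` near `A₀`;
* conclusion: `A ↦ sSup (g A '' [a, τ A])` is continuous at `A₀`.

Proof (Mathlib only). Heine–Cantor on `K` gives `η > 0` such that points of `K` at (sup-metric)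
distance `< η` have `g`-values within `e/2`. For `|A - A₀| < min d₁ (min η δ)` (with `d₁` from the
`τ`-hypothesis at tolerance `min η δ`) both slices `[a, τ A]` and `[a, T]` sit inside `K`, the two
images are bounded above (compactness), and clamping `t ↦ min t T`, resp. `t ↦ min t (τ A)`, moves
a time by less than `η` (`supContinuity_abs_sub_min_le`), so each running supremum is at most the
other one plus `e/2` (`supContinuity_sSup_le`). Hence the two suprema differ by less than `e`.

## References

* T. Tao, *Finite time blowup for an averaged three-dimensional Navier–Stokes equation*, J. Amer.
  Math. Soc. 29 (2016), 601–674, §5 (context only; the lemma itself is folklore real analysis).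
-/

noncomputable section

-- the summit namespace `…NavierStokesRegularity.NavierStokesRegularity…` is the tree convention
set_option linter.dupNamespace false

open Set Filter Topology

namespace Summit.NavierStokesRegularity.NavierStokesRegularity.Theorems.PerpetualPumpAveragedTypeIBlowup

/-- **Clamping estimate.** If `t ≤ s`, then replacing `t` by `min t r` moves it by at most
`|s - r|`. [folklore] -/
theorem supContinuity_abs_sub_min_le {t s : ℝ} (r : ℝ) (h : t ≤ s) :
    |t - min t r| ≤ |s - r| := by
  rcases le_total t r with htr | htr
  · rw [min_eq_left htr, sub_self, abs_zero]
    exact abs_nonneg _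
  · rw [min_eq_right htr, abs_of_nonneg (sub_nonneg.2 htr)]
    exact (sub_le_sub_right h r).trans (le_abs_self _)

/-- **Bounded slices.** If `Function.uncurry g` is continuous on `K` and the slice
`{B} × [a, s]` lies in `K`, then `g B` is continuous on `[a, s]`, so `g B '' [a, s]` is compact,
hence bounded above. [folklore] -/
theorem supContinuity_bddAbove {g : ℝ → ℝ → ℝ} {K : Set (ℝ × ℝ)}
    (hg : ContinuousOn (Function.uncurry g) K) {B a s : ℝ}
    (hK : ∀ t ∈ Icc a s, (B, t) ∈ K) : BddAbove (g B '' Icc a s) := by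
  have hc : ContinuousOn (g B) (Icc a s) :=
    hg.comp (Continuous.prodMk_right B).continuousOn hK
  exact (isCompact_Icc.image_of_continuousOn hc).bddAbove

/-- **One-sided comparison of running suprema.** Let `g` have modulus `η ↦ ε` on `K` for the
product (sup) metric, let the slices `{A} × [a, s]` and `{B} × [a, r]` lie in `K` (`a ≤ s`,
`a ≤ r`), with `|A - B| < η` and `|s - r| < η`, and let `g B '' [a, r]` be bounded above. Then
`sSup (g A '' [a, s]) ≤ sSup (g B '' [a, r]) + ε`: every `t ∈ [a, s]` is compared with the
clamped time `min t r ∈ [a, r]`, which is `η`-close to it. [folklore] -/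
theorem supContinuity_sSup_le {g : ℝ → ℝ → ℝ} {K : Set (ℝ × ℝ)} {η ε : ℝ}
    (hgη : ∀ x ∈ K, ∀ y ∈ K, dist x y < η →
      dist (Function.uncurry g x) (Function.uncurry g y) < ε)
    {A B a s r : ℝ} (has : a ≤ s) (har : a ≤ r) (hAK : ∀ t ∈ Icc a s, (A, t) ∈ K)
    (hBK : ∀ t ∈ Icc a r, (B, t) ∈ K) (hAB : |A - B| < η) (hsr : |s - r| < η)
    (hbdd : BddAbove (g B '' Icc a r)) :
    sSup (g A '' Icc a s) ≤ sSup (g B '' Icc a r) + ε := by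
  refine csSup_le ⟨g A a, a, left_mem_Icc.2 has, rfl⟩ ?_
  rintro y ⟨t, ht, rfl⟩
  have ht' : min t r ∈ Icc a r := ⟨le_min ht.1 har, min_le_right t r⟩
  have hdist : dist (A, t) (B, min t r) < η := by
    rw [Prod.dist_eq, Real.dist_eq, Real.dist_eq]
    exact max_lt hAB ((supContinuity_abs_sub_min_le r ht.2).trans_lt hsr)
  have h := hgη (A, t) (hAK t ht) (B, min t r) (hBK _ ht') hdist
  rw [Function.uncurry_apply_pair, Function.uncurry_apply_pair, Real.dist_eq] at h
  have h1 : g A t - g B (min t r) < ε := (abs_sub_lt_iff.1 h).1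
  have h2 : g B (min t r) ≤ sSup (g B '' Icc a r) := le_csSup hbdd ⟨min t r, ht', rfl⟩
  linarith

/-- **Stub `supContinuity`** (Mathlib-only). If `Function.uncurry g` is continuous on the rectangle
`[A₀ - δ, A₀ + δ] × [a, T + δ]` (`a ≤ T`, `0 < δ`), `τ A₀ = T`, and `τ` is continuous at `A₀` with
`a ≤ τ A` near `A₀`, then the running supremum `A ↦ sSup (g A '' [a, τ A])` is continuous at `A₀`.
[folklore] -/
theorem stub_supContinuity :
    ∀ (g : ℝ → ℝ → ℝ) (τ : ℝ → ℝ) (A₀ a T δ : ℝ), a ≤ T → 0 < δ →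
      ContinuousOn (Function.uncurry g) (Icc (A₀ - δ) (A₀ + δ) ×ˢ Icc a (T + δ)) →
      τ A₀ = T → (∀ e : ℝ, 0 < e → ∃ d : ℝ, 0 < d ∧ ∀ A : ℝ, |A - A₀| < d → |τ A - T| < e ∧ a ≤ τ A) →
      ContinuousAt (fun A : ℝ => sSup ((g A) '' Icc a (τ A))) A₀ := by
  intro g τ A₀ a T δ haT hδ hg hτ₀ hτ
  have hKc : IsCompact (Icc (A₀ - δ) (A₀ + δ) ×ˢ Icc a (T + δ)) := isCompact_Icc.prod isCompact_Icc
  rw [Metric.continuousAt_iff]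
  intro e he
  obtain ⟨η, hη, hgη⟩ := Metric.uniformContinuousOn_iff.1
    (hKc.uniformContinuousOn_of_continuous hg) (e / 2) (half_pos he)
  obtain ⟨d₁, hd₁, hτd⟩ := hτ (min η δ) (lt_min hη hδ)
  refine ⟨min d₁ (min η δ), lt_min hd₁ (lt_min hη hδ), ?_⟩
  intro A hA
  rw [Real.dist_eq] at hA
  have hAd₁ : |A - A₀| < d₁ := hA.trans_le (min_le_left _ _)
  have hAη : |A - A₀| < η := hA.trans_le ((min_le_right _ _).trans (min_le_left _ _))
  have hAδ : |A - A₀| < δ := hA.trans_le ((min_le_right _ _).trans (min_le_right _ _))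
  obtain ⟨hτA, haτ⟩ := hτd A hAd₁
  have hτη : |τ A - T| < η := hτA.trans_le (min_le_left _ _)
  have hτδ : |τ A - T| < δ := hτA.trans_le (min_le_right _ _)
  have hAmem : A ∈ Icc (A₀ - δ) (A₀ + δ) := by
    rw [abs_sub_lt_iff] at hAδ
    constructor <;> linarith
  have hA₀mem : A₀ ∈ Icc (A₀ - δ) (A₀ + δ) := by constructor <;> linarith
  have hτle : τ A ≤ T + δ := by
    rw [abs_sub_lt_iff] at hτδ
    linarith
  have hAK : ∀ t ∈ Icc a (τ A), (A, t) ∈ Icc (A₀ - δ) (A₀ + δ) ×ˢ Icc a (T + δ) :=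
    fun t ht => mk_mem_prod hAmem ⟨ht.1, ht.2.trans hτle⟩
  have hBK : ∀ t ∈ Icc a T, (A₀, t) ∈ Icc (A₀ - δ) (A₀ + δ) ×ˢ Icc a (T + δ) :=
    fun t ht => mk_mem_prod hA₀mem ⟨ht.1, ht.2.trans (by linarith)⟩
  have h1 : sSup (g A '' Icc a (τ A)) ≤ sSup (g A₀ '' Icc a T) + e / 2 :=
    supContinuity_sSup_le hgη haτ haT hAK hBK hAη hτη (supContinuity_bddAbove hg hBK)
  have h2 : sSup (g A₀ '' Icc a T) ≤ sSup (g A '' Icc a (τ A)) + e / 2 :=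
    supContinuity_sSup_le hgη haT haτ hBK hAK (by rwa [abs_sub_comm]) (by rwa [abs_sub_comm])
      (supContinuity_bddAbove hg hAK)
  show dist (sSup (g A '' Icc a (τ A))) (sSup (g A₀ '' Icc a (τ A₀))) < e
  rw [hτ₀, Real.dist_eq, abs_sub_lt_iff]
  constructor <;> linarith

end Summit.NavierStokesRegularity.NavierStokesRegularity.Theorems.PerpetualPumpAveragedTypeIBlowup
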